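import Mathlib
import HarnessLib
import Literature.MathematicalPhysics.QuantumLattice.SectorisedIncrementBoundGradedWeightedOrientedPlateau
import Literature.MathematicalPhysics.QuantumLattice.FermiRG.BGM2006OrientationOracle
import Summits.HubbardSuperconductivity.HubbardSuperconductivity.Theorems.KLProgrammeKLRegimeEngineTowerBlockStepWtFull

/-!
# Route `KLProgramme` — crux K3 ENGINE (stmt-HubbardSuperconductivity-20437 `KLRegimeEngineV17F2`), stub (b) v2, THE LEVELS PACKAGE (ℓ):
# cure of located item #10 «(ℓ)-LEV-ODD» — the ORIENTED (levelled) weighted-prescribed door AT A BLOCK STEP, orientation oracle discharged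
# (LEV-FLOOR-DESIGN-v2 (evidence #57) §5 work list (E)/(I); cell gate-hubbard-kl, seat hubbard-kl-k3c2-p3 g13 as SUBSTITUTE typer — E1 may rename / supersede)

The oriented twin of `…EngineTowerBlockStepWtFull.blockStep_ordersGe2_wtFull_le`: the Literature door
`SectorisedIncrementBoundGradedWeightedOrientedPlateau.sum_filter_wt_norm_sectorAnalysis_effAction_sub_gaussConv_le_graded_oriented_of_plateau`
(BGM 2006 App. A4 (A4.8): every tree line read the standard or the swapped way, every input vertex estimated by its LEVELLED anchored size at level
`F_a + swChildren a + [a root ∨ o a]`) at the block geometry `Γ = C^K_{(Λ_{J₂}, Λ_{J₁}]}`, input family `F_{J₁−1}` / fat partner `F̃_{J₁−1}`, output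
family `F_{J′}`, with the plateau facts, the child relation (support overlap) and the parents count `27` discharged BY NAME exactly as in the all-known
door; the orientation ORACLE of the Literature door is discharged here by `FermiRG.exists_orientation_prod_le` (`BGM2006Routing.exists_orientation_lumps`):
for levelled sizes `Nl m′ L` antitone in `L` and dominated by `Bm m′ · θ^{lumps L}` (`L ≥ 1`) the profile functional is `(∏_a Bm (δ a)) · θ^{lumps (1 + |J|)}` —
the FLOOR credit of the whole block step read on the OUTPUT level `1 + |J|`.  Hypotheses left to the tower's instantiation (I): the talking relation `ov`
of the coarse sector legs supporting `S(F̃)ᵀ Γ S(F̃)` with its count `c` (momentum conservation + fat-support overlaps), and the two families of weighted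
sectorised prescribed sums of `G` at `F_{J₁−1}` — `B` (full pin, `|E| = F + 1 ∋ q`) and `B′` (position-only pin, `|E| = F ∌ t`, pinned position any
function of the pinned leg's sector: translation invariance) — dominated by `Nl`.

* §1 **`blockStep_ordersGe2_wtOriented_le`** — orders ≥ 2 of the block step, oriented levelled track.
Compositions of landed theorems; nothing about the model is asserted beyond them; nothing asserts (ℓ), any stub, K3 or superconductivity.
References: BGM 2006 (2.61)–(2.63), (2.66), §2.8 (2.82)–(2.84), (2.88)–(2.90), (2.97)–(2.98), App. A3 Lemma A3.1, App. A4 (A4.5)–(A4.8), §3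
[cite: BenfattoGiulianiMastropietro2006].
-/

noncomputable section

namespace Summit.HubbardSuperconductivity.HubbardSuperconductivity.Theorems.EngineV8

set_option linter.dupNamespace false -- summit = problem name (single-conjunct summit), D-0017

open Real Finset Literature.MathematicalPhysics.QuantumLattice Literature.Probability.LatticeModels GrassmannAlgebra
open Literature.MathematicalPhysics.QuantumLattice.FermiRG Literature.MathematicalPhysics.QuantumLattice.FermiRG.BGM2006Routing
open Summit.HubbardSuperconductivity.HubbardSuperconductivity.Theorems.KLProgrammeLegKernels
open Summit.HubbardSuperconductivity.HubbardSuperconductivity.Theorems.KLRegimeSplit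
open Summit.HubbardSuperconductivity.HubbardSuperconductivity.Theorems.KLRegimeWick
open Summit.HubbardSuperconductivity.HubbardSuperconductivity.Theorems.TwoPointAssembly
open Literature.Probability.LatticeModels.BattleFederbush

variable {L M : ℕ} [NeZero L] [NeZero M] {Λ : Type*} [DecidableEq Λ] {wt : Finset Λ → ℝ}

/-! ## §0 Dictionary: the lump table of the routing file is the tower's `levelGainExp` -/

/-- **The lump table of `BGM2006Routing` is the tower's `levelGainExp`** (`min ((F−1)/2) 2` on both sides): the floor credit per fixed-sector
count used by the orientation oracle is the one of the levels tower (`klLevGain t = levelGainExp (t+1)`). -/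
theorem lumps_eq_levelGainExp (F : ℕ) : lumps F = levelGainExp F := rfl

/-! ## §1 Orders ≥ 2 of a block step, oriented levelled track -/

/-- **ORDERS ≥ 2 OF A BLOCK STEP, WEIGHTED PINNED SUMS WITH PRESCRIBED OUTPUT LEGS, ORIENTED TREE LINES (the levelled door at the block geometry,
orientation oracle discharged).**  `1 ≤ J₁ ≤ J₂`, `J₁ ≤ J′`; `F := F_{J₁−1}`, `F̃ := F̃_{J₁−1}`, `F′ := F_{J′}`, `Γ := C^K_{(Λ_{J₂}, Λ_{J₁}]}`; child relation =
support overlap (parents count `27`); a talking relation `ov` of the coarse sector legs (at most `c ≥ 1` partners) supporting `S(F̃)ᵀ Γ S(F̃)`; `G` even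
without constant part; tree weight `wt` with leg maps `πi, πo`; block constants as hypotheses (`κ`, weighted `α`, weighted `(cr, cc)`, `ρ`, `θV < 1`); the
WEIGHTED PRESCRIBED input sums of `G` at `F` — full pin `B m′ F` and position-only pin `B′ m′ F` — dominated by LEVELLED sizes `Nl m′ L`
(`ε·B m′ F ≤ Nl m′ (F+1)`, `ε·B′ m′ F ≤ Nl m′ F`), `Nl` antitone in the level and `≤ Bm m′ · θ^{lumps L}` for `L ≥ 1`; output legs `J` prescribed to
`τ″`, pinned leg `p ∉ J`.  Conclusion: the weighted constrained sum of `‖kernel (map E(F′)) (effAction Γ G − e^{Δ_Γ} G) (m+1) ·‖` is bounded by the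
oriented door's right side with the profile functional `(∏_a Bm (δ a)) · θ^{lumps (1 + |J|)}`. -/
theorem blockStep_ordersGe2_wtOriented_le (hwt : IsTreeWeight wt) {β : ℝ} (hβ : 0 < β) (μ : ℝ) (K : TrigPolyC4v) {J₁ J₂ J' : ℕ}
    (hJ₁ : 1 ≤ J₁) (hJ : J₁ ≤ J₂) (hJ' : J₁ ≤ J')
    (πi : SpaceTimeIdx L M × SectorLeg (sectorCount (J₁ - 1)) → Λ) (πo : SpaceTimeIdx L M × SectorLeg (sectorCount J') → Λ)
    (G : HubbardGrassmann L M) (hG : G ∈ evenPart ℂ (HubbardFieldIdx L M)) (hG0 : constPart ℂ G = 0)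
    (σdef : SectorLeg (sectorCount (J₁ - 1)))
    (ov : SectorLeg (sectorCount (J₁ - 1)) → SectorLeg (sectorCount (J₁ - 1)) → Prop) [DecidableRel ov] {c : ℕ} (hc1 : 1 ≤ c)
    (hov : ∀ σ', (univ.filter fun σ : SectorLeg (sectorCount (J₁ - 1)) => ov σ σ').card ≤ c)
    (hCov : ∀ X Y, ((sectorSubMatrix L M β (bgmFatMultiplier L M klE0 β (nambuXiCT L μ K) (J₁ - 1))).transpose *
      hubbardCovSliceCT L M β μ 0 K (klScale klE0 J₂) (klScale klE0 J₁) *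
        sectorSubMatrix L M β (bgmFatMultiplier L M klE0 β (nambuXiCT L μ K) (J₁ - 1))) X Y ≠ 0 → ov X.2 Y.2 ∧ ov Y.2 X.2)
    {κ : ℝ} (hκ : 0 < κ)
    (hGB : IsGramBoundedR ((sectorSubMatrix L M β (bgmFatMultiplier L M klE0 β (nambuXiCT L μ K) (J₁ - 1))).transpose *
      hubbardCovSliceCT L M β μ 0 K (klScale klE0 J₂) (klScale klE0 J₁) *
        sectorSubMatrix L M β (bgmFatMultiplier L M klE0 β (nambuXiCT L μ K) (J₁ - 1))) κ)
    (B B' : ℕ → ℕ → ℝ) (hB0 : ∀ m' Fc, 0 ≤ B m' Fc)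
    (hB : ∀ (m' Fc : ℕ) (E : Finset (Fin (2 * m' + 1 + 1))) (τ : Fin (2 * m' + 1 + 1) → SectorLeg (sectorCount (J₁ - 1)))
      (q : Fin (2 * m' + 1 + 1)), q ∈ E → E.card = Fc + 1 → ∀ y : SpaceTimeIdx L M,
        imagTimeWeight β M ^ (2 * m' + 1) *
          ∑ σ ∈ univ.filter (fun σ : Fin (2 * m' + 1 + 1) → SectorLeg (sectorCount (J₁ - 1)) => ∀ e ∈ E, σ e = τ e),
            ∑ x ∈ univ.filter (fun x : Fin (2 * m' + 1 + 1) → SpaceTimeIdx L M => x q = y),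
              wt ((univ.image fun i => (x i, σ i)).image πi) *
                ‖sectorisedKernel L M β (klAnisoFamily L M β μ K klE0 (J₁ - 1)) G (2 * m' + 1 + 1) σ x‖ ≤ B (m' + 1) Fc)
    (hB' : ∀ (m' Fc : ℕ) (E : Finset (Fin (2 * m' + 1 + 1))) (τ : Fin (2 * m' + 1 + 1) → SectorLeg (sectorCount (J₁ - 1)))
      (t : Fin (2 * m' + 1 + 1)), t ∉ E → E.card = Fc → ∀ yσ : SectorLeg (sectorCount (J₁ - 1)) → SpaceTimeIdx L M,
        imagTimeWeight β M ^ (2 * m' + 1) *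
          ∑ σ ∈ univ.filter (fun σ : Fin (2 * m' + 1 + 1) → SectorLeg (sectorCount (J₁ - 1)) => ∀ e ∈ E, σ e = τ e),
            ∑ x ∈ univ.filter (fun x : Fin (2 * m' + 1 + 1) → SpaceTimeIdx L M => x t = yσ (σ t)),
              wt ((univ.image fun i => (x i, σ i)).image πi) *
                ‖sectorisedKernel L M β (klAnisoFamily L M β μ K klE0 (J₁ - 1)) G (2 * m' + 1 + 1) σ x‖ ≤ B' (m' + 1) Fc)
    (Nl : ℕ → ℕ → ℝ) (hNl0 : ∀ m' Lv, 0 ≤ Nl m' Lv) (hanti : ∀ m' Lv Lv', Lv ≤ Lv' → Nl m' Lv' ≤ Nl m' Lv)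
    (hBN : ∀ m' Fc, imagTimeWeight β M * B (m' + 1) Fc ≤ Nl (m' + 1) (Fc + 1))
    (hB'N : ∀ m' Fc, imagTimeWeight β M * B' (m' + 1) Fc ≤ Nl (m' + 1) Fc)
    (Bm : ℕ → ℝ) (hBm0 : ∀ m', 0 ≤ Bm m') {θ : ℝ} (hθ0 : 0 ≤ θ) (hdom : ∀ m' Lv, 1 ≤ Lv → Nl m' Lv ≤ Bm m' * θ ^ lumps Lv)
    {α : ℝ} (hα : 0 < α)
    (hrow : ∀ X, ∑ Y, ‖((sectorSubMatrix L M β (bgmFatMultiplier L M klE0 β (nambuXiCT L μ K) (J₁ - 1))).transpose *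
        hubbardCovSliceCT L M β μ 0 K (klScale klE0 J₂) (klScale klE0 J₁) *
          sectorSubMatrix L M β (bgmFatMultiplier L M klE0 β (nambuXiCT L μ K) (J₁ - 1))) X Y‖ * wt {πi X, πi Y} ≤ α)
    (hcol : ∀ Y, ∑ X, ‖((sectorSubMatrix L M β (bgmFatMultiplier L M klE0 β (nambuXiCT L μ K) (J₁ - 1))).transpose *
        hubbardCovSliceCT L M β μ 0 K (klScale klE0 J₂) (klScale klE0 J₁) *
          sectorSubMatrix L M β (bgmFatMultiplier L M klE0 β (nambuXiCT L μ K) (J₁ - 1))) X Y‖ * wt {πi X, πi Y} ≤ α)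
    {ρ : ℝ} (hρ : 0 < ρ)
    (hθV : Real.exp 1 * α * normV (SpaceTimeIdx L M × SectorLeg (sectorCount (J₁ - 1))) κ ρ
      (fun m' => imagTimeWeight β M * B m' 0) / κ ^ 2 < 1)
    {cr cc : ℝ} (hcc0 : 0 ≤ cc)
    (hrow' : ∀ X'', ∑ X', ‖(sectorAnalysisMatrix L M β (klAnisoFamily L M β μ K klE0 J') *
        sectorSubMatrix L M β (bgmFatMultiplier L M klE0 β (nambuXiCT L μ K) (J₁ - 1))) X'' X'‖ * wt {πo X'', πi X'} ≤ cr)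
    (hcol' : ∀ X', ∑ X'', ‖(sectorAnalysisMatrix L M β (klAnisoFamily L M β μ K klE0 J') *
        sectorSubMatrix L M β (bgmFatMultiplier L M klE0 β (nambuXiCT L μ K) (J₁ - 1))) X'' X'‖ * wt {πo X'', πi X'} ≤ cc)
    {N₀ : ℕ} (hN₀ : 2 ≤ N₀) {m : ℕ} (p : Fin (m + 1)) (J : Finset (Fin (m + 1))) (hp : p ∉ J)
    (τ'' : Fin (m + 1) → SectorLeg (sectorCount J')) (w'' : SpaceTimeIdx L M × SectorLeg (sectorCount J')) :
    ∑ X'' ∈ univ.filter (fun X'' : Fin (m + 1) → SpaceTimeIdx L M × SectorLeg (sectorCount J') => X'' p = w'' ∧ ∀ j ∈ J, (X'' j).2 = τ'' j),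
        wt ((univ.image X'').image πo) *
          ‖kernel ℂ (ExteriorAlgebra.map (Matrix.toLin' (sectorAnalysisMatrix L M β (klAnisoFamily L M β μ K klE0 J')))
            (effAction ℂ (hubbardCovSliceCT L M β μ 0 K (klScale klE0 J₂) (klScale klE0 J₁)) G -
              gaussConv ℂ (hubbardCovSliceCT L M β μ 0 K (klScale klE0 J₂) (klScale klE0 J₁)) G)) (m + 1) X''‖ ≤
      cr * cc ^ m * ((∏ j ∈ J, (((univ.filter fun ℓ' : SectorLeg (sectorCount (J₁ - 1)) =>
          (∃ q : FreqMomentum L M, klAnisoFamily L M β μ K klE0 J' (τ'' j).1.1 q ≠ 0 ∧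
            bgmFatMultiplier L M klE0 β (nambuXiCT L μ K) (J₁ - 1) ℓ'.1.1 q ≠ 0) ∧
          ℓ'.1.2 = (τ'' j).1.2 ∧ ℓ'.2 = (τ'' j).2).card : ℕ) : ℝ)) *
        (∑ n ∈ Ico 2 N₀, (κ⁻¹ ^ (m + 1) * κ⁻¹ ^ (2 * (n - 1)) * ((c * α) ^ (n - 1) * Real.exp n)) *
            ∑ δ ∈ (Fintype.piFinset fun _ : Fin n => range (Fintype.card (SpaceTimeIdx L M × SectorLeg (sectorCount (J₁ - 1))) / 2 + 1)) with
                m + 1 + 2 * (n - 1) ≤ ∑ a, 2 * δ a,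
              ∑ pf : J → Fin n, ((∏ j, ((2 * δ (pf j) : ℕ) : ℝ)) / ((∑ a, 2 * δ a : ℕ) : ℝ) ^ J.card) *
                ((Real.exp 3 * κ) ^ (∑ a, 2 * δ a) * ((∏ a, Bm (δ a)) * θ ^ lumps (1 + J.card))) +
          ρ⁻¹ ^ (m + 1) * (Real.exp 1 * normV (SpaceTimeIdx L M × SectorLeg (sectorCount (J₁ - 1))) κ ρ
              (fun m' => imagTimeWeight β M * B m' 0)) *
            (Real.exp 1 * α * normV (SpaceTimeIdx L M × SectorLeg (sectorCount (J₁ - 1))) κ ρ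
                (fun m' => imagTimeWeight β M * B m' 0) / κ ^ 2) ^ (N₀ - 1) /
            (1 - Real.exp 1 * α * normV (SpaceTimeIdx L M × SectorLeg (sectorCount (J₁ - 1))) κ ρ
                (fun m' => imagTimeWeight β M * B m' 0) / κ ^ 2))) := by
  classical
  have he : (0 : ℝ) < klE0 := by norm_num [klE0]
  have hkJ : J₁ - 1 ≤ J' := by omega
  -- the orientation oracle, discharged by the level routing
  have hNφ : ∀ (n : ℕ) (δ : Fin n → ℕ) (b : Fin n) {k : ℕ} (s : Script b k), s.Valid → univ.image s.y = univ → ∀ pf : J → Fin n,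
      ∃ o : Fin n → Bool, ∏ a, Nl (δ a) ((univ.filter fun j : J => pf j = a).card +
        swChildren s o a + if a = b ∨ o a = true then 1 else 0) ≤ (∏ a, Bm (δ a)) * θ ^ lumps (1 + J.card) :=
    fun n δ b k s hs hcov pf => exists_orientation_prod_le s hs hcov J pf (fun a => Nl (δ a)) (fun a Lv => hNl0 _ _)
      (fun a Lv Lv' h => hanti _ _ _ h) (fun a => Bm (δ a)) (fun a Lv hL => hdom _ _ hL)
  have hNφ0 : ∀ (n : ℕ) (δ : Fin n → ℕ) (_pf : J → Fin n), 0 ≤ (∏ a, Bm (δ a)) * θ ^ lumps (1 + J.card) :=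
    fun n δ _ => mul_nonneg (prod_nonneg fun a _ => hBm0 _) (pow_nonneg hθ0 _)
  exact sum_filter_wt_norm_sectorAnalysis_effAction_sub_gaussConv_le_graded_oriented_of_plateau hwt πi πo hβ
    (klAnisoFamily L M β μ K klE0 (J₁ - 1)) (bgmFatMultiplier L M klE0 β (nambuXiCT L μ K) (J₁ - 1))
    (fun ω k => bgmFatMultiplier_mul_bgmMultiplier he β (nambuXiCT L μ K) (J₁ - 1) ω k)
    (fun k hk ω => klAnisoFamily_eq_zero_of_sum_eq_zero β μ K klE0 (J₁ - 1) k hk ω)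
    (klAnisoFamily L M β μ K klE0 J') G hG hG0 _
    (fun X Y hXY => sum_klAnisoFamily_eq_one_of_blockSliceCT_ne_zero β μ K hJ₁ hJ X Y hXY)
    (fun ω' k hne => sum_klAnisoFamily_pred_eq_one_of_klAnisoFamily_ne_zero β μ K hJ₁ hJ' ω' k hne)
    (fun ω'' ω' => ∃ q : FreqMomentum L M, klAnisoFamily L M β μ K klE0 J' ω'' q ≠ 0 ∧
      bgmFatMultiplier L M klE0 β (nambuXiCT L μ K) (J₁ - 1) ω' q ≠ 0)
    (fun X'' X' hne => overlap_of_sectorAnalysis_mul_sectorSub_ne_zero β _ _ X'' X' hne)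
    σdef ov hc1 hov hCov hκ hGB B B' hB0 hB hB' Nl hNl0 hBN hB'N p J hp τ''
    (fun n δ pf => (∏ a, Bm (δ a)) * θ ^ lumps (1 + J.card)) hNφ0 hNφ
    hα hrow hcol hρ hθV hcc0 hrow' hcol' hN₀ w''

end Summit.HubbardSuperconductivity.HubbardSuperconductivity.Theorems.EngineV8
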